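import Summits.Ventures.Crystal3D.Theorems.StickyWulffConstantTextureLiminfTexShadowTerraceCensusThree
import HarnessLib

/-!
# Trigonometry of a certified arrival at an h-row END: the star constraints force `cos(d, u) ≤ −1/3`; rising arrivals have `cos(d, u) > −1/3`
# (crux `GenericWallFloor`, stmt-Ventures-19480, kernel G; third brick of TRACK 2′ = the structural proof of `HRowEndFarApart (3/4)`; 19480-p2 g14)

HONEST FRAMING. Venture `Summits/Ventures/Crystal3D` (cell `crystal3d-full`), route `route-Ventures-StickyWulffConstant`, helper for the crux
`GenericWallFloor` (stmt-Ventures-19480) / consumer `TextureLiminfV5` (stmt-Ventures-23912).  Pure real (in)equalities; standard axioms; F-C1 not moved.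

THE POINT.  At an h-row end `e = p + u` (model frame, `u = (1,0,0)`) the h-star of `e` consists of `p` and the four balls `e + sᵢ`,
`s₁,₂ = (−½, ±√3/2, 0)`, `s₃,₄ = (−½, √3/6, ±√(2/3))`.  For an arrival direction `d` (unit) from a complete predecessor `p′ = e − d` OUTSIDE `p`'s dozen, the
√2-gaps give `⟪u, d⟫ ≤ 0` and, for each `i`, `⟪sᵢ, d⟫ ≥ 0` (the star ball is `≥ √2` from `p′`) or `⟪sᵢ, d⟫ = −½` (it is a member of `p′`'s dozen).
In the rational variables `d₀ = ⟪u,d⟫`, `P = (√3/2) d₁`, `Q = √(2/3) d₂` (`d₀² + 4P²/3 + 3Q²/2 = 1`; `⟪s₁,d⟫ = −d₀/2 + P`, `⟪s₂,d⟫ = −d₀/2 − P`,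
`⟪s₃,d⟫ = −d₀/2 + P/3 + Q`, `⟪s₄,d⟫ = −d₀/2 + P/3 − Q`):
* `trig_forward` — all four `≥ 0` ⇒ `d₀ ≤ −1/3` (indeed `≤ −1/√2`: the generic forward cone);
* `trig_equatorial` — `⟪s₁, d⟫ = −½` (an equatorial star ball in `p′`'s dozen) ⇒ `d₀ ≤ −1/3` (with equality exactly at the isolated apart configuration
  `3d₀² − 2d₀ − 1 = 0`); `trig_polar` — `⟪s₁,d⟫, ⟪s₂,d⟫ ≥ 0` and a polar coincidence ⇒ `d₀ ≤ −1/3`;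
* **`star_constraints_le`** — the sixteen-case union: `d₀ ≤ −1/3`, or the OCTAHEDRAL configuration `(d₀, P, Q) = (0, ½, ±2/3)` (the predecessor
  at the square-hole site of `p`'s dozen next to `e`: four shared balls, a COAXIAL reading — excluded by apartness in the assembly);
* **`inner_gt_of_rising`** — unit `u, d, ζ` with `⟪u, ζ⟫ ≥ 3/4`, `⟪d, ζ⟫ ≥ 3/8` ⇒ `⟪u, d⟫ > −1/3` (Gram determinant `sq_inner_sub_mul_le` of
  …TerraceCensusThree: `(59/96)² > 385/1024`).
WHAT THIS IS NOT: no configuration; F-C1 not moved.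
-/

noncomputable section

namespace Summit.Ventures.Crystal3D.Theorems

open scoped InnerProductSpace

/-! ### The star constraints in rational variables -/

/-- **Forward cone**: all four star constraints non-negative ⇒ `d₀ ≤ −1/3`. -/
theorem trig_forward {d₀ P Q : ℝ} (hnorm : d₀ ^ 2 + 4 / 3 * P ^ 2 + 3 / 2 * Q ^ 2 = 1)
    (h1 : 0 ≤ -d₀ / 2 + P) (h2 : 0 ≤ -d₀ / 2 - P) (h3 : 0 ≤ -d₀ / 2 + P / 3 + Q) (h4 : 0 ≤ -d₀ / 2 + P / 3 - Q) : d₀ ≤ -1 / 3 := by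
  have hP : P ^ 2 ≤ d₀ ^ 2 / 4 := by nlinarith [mul_nonneg h1 h2]
  have hQ : Q ^ 2 ≤ (-d₀ / 2 + P / 3) ^ 2 := by nlinarith [mul_nonneg h3 h4]
  have hd : d₀ ≤ 0 := by linarith
  nlinarith [sq_nonneg (P + d₀ / 2), sq_nonneg (d₀ + 1 / 3)]

/-- **An equatorial coincidence** (`⟪s₁, d⟫ = −½`) with `d₀ ≤ 0` ⇒ `d₀ ≤ −1/3`. -/
theorem trig_equatorial {d₀ P Q : ℝ} (hnorm : d₀ ^ 2 + 4 / 3 * P ^ 2 + 3 / 2 * Q ^ 2 = 1) (hd : d₀ ≤ 0)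
    (h1 : -d₀ / 2 + P = -1 / 2) (h3 : 0 ≤ -d₀ / 2 + P / 3 + Q ∨ -d₀ / 2 + P / 3 + Q = -1 / 2)
    (h4 : 0 ≤ -d₀ / 2 + P / 3 - Q ∨ -d₀ / 2 + P / 3 - Q = -1 / 2) : d₀ ≤ -1 / 3 := by
  have hP : P = d₀ / 2 - 1 / 2 := by linarith
  subst hP
  rcases h3 with h3 | h3 <;> rcases h4 with h4 | h4
  · -- both non-negative: `A = −d₀/3 − 1/6 ≥ |Q| ≥ 0`
    nlinarith
  · -- polar coincidence below: `Q = d₀/3 − 1/3 + …`; the norm gives `3d₀² − 2d₀ − 1 = 0`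
    have hQ : Q = -d₀ / 2 + (d₀ / 2 - 1 / 2) / 3 + 1 / 2 := by linarith
    subst hQ
    have hpoly : 3 * d₀ ^ 2 - 2 * d₀ - 1 = 0 := by nlinarith
    nlinarith
  · have hQ : Q = -(-d₀ / 2 + (d₀ / 2 - 1 / 2) / 3 + 1 / 2) := by linarith
    subst hQ
    have hpoly : 3 * d₀ ^ 2 - 2 * d₀ - 1 = 0 := by nlinarith
    nlinarith
  · -- both polar coincidences: `Q = 0` and then `d₀ = 1`, excluded
    have hQ : Q = 0 := by linarith
    subst hQ
    nlinarith

/-- The other equatorial coincidence `⟪s₂, d⟫ = −½`: `d₀ ≤ −1/3`, OR the OCTAHEDRAL configuration `d₀ = 0`, `P = ½`, `Q = ±2/3` (the predecessor at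
the square-hole site of `p`'s dozen adjacent to `e` — four shared balls, coaxial reading; excluded by apartness downstream, not by trigonometry). -/
theorem trig_equatorial' {d₀ P Q : ℝ} (hnorm : d₀ ^ 2 + 4 / 3 * P ^ 2 + 3 / 2 * Q ^ 2 = 1) (hd : d₀ ≤ 0)
    (h2 : -d₀ / 2 - P = -1 / 2) (h3 : 0 ≤ -d₀ / 2 + P / 3 + Q ∨ -d₀ / 2 + P / 3 + Q = -1 / 2)
    (h4 : 0 ≤ -d₀ / 2 + P / 3 - Q ∨ -d₀ / 2 + P / 3 - Q = -1 / 2) (h1 : 0 ≤ -d₀ / 2 + P ∨ -d₀ / 2 + P = -1 / 2) :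
    d₀ ≤ -1 / 3 ∨ (d₀ = 0 ∧ P = 1 / 2 ∧ (Q = 2 / 3 ∨ Q = -2 / 3)) := by
  have hP : P = 1 / 2 - d₀ / 2 := by linarith
  subst hP
  rcases h1 with h1 | h1
  · rcases h3 with h3 | h3 <;> rcases h4 with h4 | h4
    · left; nlinarith
    · -- `σ₄ = −½`: `Q = 2/3 − 2d₀/3`, the norm gives `d₀ (d₀ − 1) = 0`
      have hQ : Q = -d₀ / 2 + (1 / 2 - d₀ / 2) / 3 + 1 / 2 := by linarith
      subst hQ
      have hpoly : d₀ * (d₀ - 1) = 0 := by nlinarith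
      have hd0 : d₀ = 0 := by
        rcases mul_eq_zero.1 hpoly with h | h
        · exact h
        · linarith
      subst hd0
      right; refine ⟨rfl, by ring, Or.inl (by ring)⟩
    · have hQ : Q = -(-d₀ / 2 + (1 / 2 - d₀ / 2) / 3 + 1 / 2) := by linarith
      subst hQ
      have hpoly : d₀ * (d₀ - 1) = 0 := by nlinarith
      have hd0 : d₀ = 0 := by
        rcases mul_eq_zero.1 hpoly with h | h
        · exact h
        · linarith
      subst hd0
      right; refine ⟨rfl, by ring, Or.inr (by ring)⟩
    · have hQ : Q = 0 := by linarith
      subst hQ; left; nlinarith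
  · -- both equatorial coincidences: `d₀ = 1`
    left; nlinarith

/-- **A polar coincidence with both equatorial constraints non-negative** is impossible unless `d₀ ≤ −1/3`. -/
theorem trig_polar {d₀ P Q : ℝ} (hnorm : d₀ ^ 2 + 4 / 3 * P ^ 2 + 3 / 2 * Q ^ 2 = 1)
    (h1 : 0 ≤ -d₀ / 2 + P) (h2 : 0 ≤ -d₀ / 2 - P) (h34 : -d₀ / 2 + P / 3 + Q = -1 / 2 ∨ -d₀ / 2 + P / 3 - Q = -1 / 2) : d₀ ≤ -1 / 3 := by
  by_contra hcon
  push Not at hcon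
  have hd : d₀ ≤ 0 := by linarith
  have hPabs : P ^ 2 ≤ d₀ ^ 2 / 4 := by nlinarith [mul_nonneg h1 h2]
  -- `|Q| = ½ + A` with `A = −d₀/2 + P/3 ∈ [0, −2d₀/3]`, so `3Q²/2 ≥ 3/8`, while the norm leaves `3Q²/2 = 1 − d₀² − 4P²/3`
  rcases h34 with h | h
  · have hQ : Q = -1 / 2 - (-d₀ / 2 + P / 3) := by linarith
    rw [hQ] at hnorm
    nlinarith [sq_nonneg (P + d₀ / 2)]
  · have hQ : Q = 1 / 2 + (-d₀ / 2 + P / 3) := by linarith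
    rw [hQ] at hnorm
    nlinarith [sq_nonneg (P + d₀ / 2)]

/-- **THE STAR CONSTRAINTS** (union of all cases): `d₀ ≤ 0` and, for each of the four star directions, «non-negative or exactly `−½`» ⇒
`d₀ ≤ −1/3`, or the octahedral configuration `(d₀, P, Q) = (0, ½, ±2/3)`. -/
theorem star_constraints_le {d₀ P Q : ℝ} (hnorm : d₀ ^ 2 + 4 / 3 * P ^ 2 + 3 / 2 * Q ^ 2 = 1) (hd : d₀ ≤ 0)
    (h1 : 0 ≤ -d₀ / 2 + P ∨ -d₀ / 2 + P = -1 / 2) (h2 : 0 ≤ -d₀ / 2 - P ∨ -d₀ / 2 - P = -1 / 2)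
    (h3 : 0 ≤ -d₀ / 2 + P / 3 + Q ∨ -d₀ / 2 + P / 3 + Q = -1 / 2) (h4 : 0 ≤ -d₀ / 2 + P / 3 - Q ∨ -d₀ / 2 + P / 3 - Q = -1 / 2) :
    d₀ ≤ -1 / 3 ∨ (d₀ = 0 ∧ P = 1 / 2 ∧ (Q = 2 / 3 ∨ Q = -2 / 3)) := by
  rcases h1 with h1 | h1
  · rcases h2 with h2 | h2
    · rcases h3 with h3 | h3
      · rcases h4 with h4 | h4
        · exact Or.inl (trig_forward hnorm h1 h2 h3 h4)
        · exact Or.inl (trig_polar hnorm h1 h2 (Or.inr h4))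
      · exact Or.inl (trig_polar hnorm h1 h2 (Or.inl h3))
    · exact trig_equatorial' hnorm hd h2 h3 h4 (Or.inl h1)
  · exact Or.inl (trig_equatorial hnorm hd h1 h3 h4)

/-! ### Rising arrivals -/

/-- **RISING ARRIVALS POINT BACKWARD BY MORE THAN `arccos(−1/3)`**: for unit `u, d, ζ` with `⟪u, ζ⟫ ≥ 3/4` and `⟪d, ζ⟫ ≥ 3/8`: `⟪u, d⟫ > −1/3`
(`cos(arccos ¾ + arccos ⅜) = 9/32 − √385/32 > −1/3` since `(59/3)² = 3481/9 > 385`). -/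
theorem inner_gt_of_rising {u d ζ : EuclideanSpace ℝ (Fin 3)} (hu : ‖u‖ = 1) (hd : ‖d‖ = 1) (hζ : ‖ζ‖ = 1)
    (hsteep : (3 : ℝ) / 4 ≤ ⟪u, ζ⟫_ℝ) (hrise : (3 : ℝ) / 8 ≤ ⟪d, ζ⟫_ℝ) : -(1 : ℝ) / 3 < ⟪u, d⟫_ℝ := by
  have hG := Summit.Ventures.Crystal3D.Cruxes.TextureLiminf.TexShadow.sq_inner_sub_mul_le hu hd hζ
  have ha1 : ⟪u, ζ⟫_ℝ ≤ 1 := by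
    have := abs_real_inner_le_norm u ζ; rw [hu, hζ, one_mul] at this; exact (abs_le.1 this).2
  have hb1 : ⟪d, ζ⟫_ℝ ≤ 1 := by
    have := abs_real_inner_le_norm d ζ; rw [hd, hζ, one_mul] at this; exact (abs_le.1 this).2
  by_contra hcon
  push Not at hcon
  set a := ⟪u, ζ⟫_ℝ
  set b := ⟪d, ζ⟫_ℝ
  set x := ⟪u, d⟫_ℝ
  have hab : 9 / 32 ≤ a * b := by nlinarith
  have hlow : (59 / 96 : ℝ) ^ 2 ≤ (x - a * b) ^ 2 := by nlinarith
  have hup : (1 - a ^ 2) * (1 - b ^ 2) ≤ 7 / 16 * (55 / 64) := by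
    have h1 : 1 - a ^ 2 ≤ 7 / 16 := by nlinarith
    have h2 : 1 - b ^ 2 ≤ 55 / 64 := by nlinarith
    have h3 : 0 ≤ 1 - a ^ 2 := by nlinarith
    have h4 : 0 ≤ 1 - b ^ 2 := by nlinarith
    calc (1 - a ^ 2) * (1 - b ^ 2) ≤ 7 / 16 * (1 - b ^ 2) := mul_le_mul_of_nonneg_right h1 h4
      _ ≤ 7 / 16 * (55 / 64) := by nlinarith
  nlinarith

end Summit.Ventures.Crystal3D.Theorems

end
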